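import Mathlib
import HarnessLib
import HarnessLib.Audit
import Summits.Schanuel.Statement
import HarnessLib.Audit.Status.Attr

/-!
Route: AlgIndepMethod

DORMANT since 2026-08-23T12:31:15Z (reconciler: no traction for 6.1 d (last activity item-evidence-added at 2026-08-17T10:05:08Z); parked, not closed — `ledger route dormant route-Schanuel-AlgIndepMethod --off` to reactivate) — unstaffed, not closed; items shared with open routes are served there. `ledger route dormant <id> --off` reactivates.

# Route Schanuel/AlgIndepMethod — Cartesian-product (several-variables) form and the Gelfond–Diaz
ladder

## Thesis X
Words: it suffices to show X = CartesianSchanuelThesis: for x ∈ ℂ^d, y ∈ ℂ^ℓ with the dℓ products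
xᵢyⱼ
ℚ-linearly independent, trdeg_ℚ ℚ(x, y, e^{xᵢyⱼ}) ≥ dℓ. The d = 1, x = (1) column IS Schanuel (the
route's
deciding theorem `closes`, kernel-checked), and Schanuel ⇒ X by applying it to the products
(Literature.Barriers.Schanuel.cartesianSchanuel_of_schanuel), so X ⟺ Schanuel; the staffed items are
three
rungs of the grid strictly below X, each a consequence of Schanuel: log α ⊥ α^β; the Gel'fond–Diaz
ladder
α^β, …, α^{β^{d−1}} at full strength d − 1; and large transcendence degree WITHOUT the Technical
Hypothesis
(NesterenkoPhilippon2001 Ch.14 Thm 2.7 minus Definition 2.6 = Conj 2.3, t-clause) — the last being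
the move
the several-variables algebraic-independence method would actually have to make.
Lean (elaborates; Mathlib only):
`∀ (d l : ℕ) (x : Fin d → ℂ) (y : Fin l → ℂ), LinearIndependent ℚ (fun p : Fin d × Fin l => x p.1 *
y p.2) → ((d * l : ℕ) : Cardinal) ≤ Algebra.trdeg ℚ ↥(IntermediateField.adjoin ℚ (Set.range x ∪
Set.range y ∪ Set.range (fun p : Fin d × Fin l => Complex.exp (x p.1 * y p.2))))`

## Assembly
Pure bookkeeping, now DONE where it counts: the deciding theorem `closes : CartesianSchanuelThesis →
LogAlphaAlphaBetaAlgIndep → GelfondDiazLadderFull → LargeTrdegWithoutTH → Diaz1989 →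
AlgindepLadderLe3OfDiaz → Assembly →
Schanuel` (glue.lean, sorry-free, axioms propext /
Classical.choice / Quot.sound) specialises X at d = 1, x = ![1]: the products ![1] p.1 · z p.2 are z
p.2
(reindex along Equiv.uniqueProd : Fin 1 × Fin n ≃ Fin n, so ℚ-linear independence of z transfers),
Set.range ![1] = {1} adds nothing to ℚ(z, e^z) (one_mem), and (1·n : ℕ) = n in Cardinal. Only the
target is
used; the rungs and `Assembly` are hypotheses of `closes` because they are items, not because the
glue needs them.
The item `Assembly` is restated BY NAME, `CartesianSchanuelThesis → Schanuel` (its old inline-body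
form was the
glue.extra-hypothesis finding; the gate keeps one assembly item per route, so it is not dropped):
provable now by the
same thirty-line specialisation, an idle prover's item, and nothing in the route waits on it.

Rationale: WHY THIS LINE. Imports: Gel'fond's algebraic-independence method in several variables (auxiliary
function + zero estimate + criterion for algebraic independence), transcendence measures. The
(d,ℓ)-grid {e^{xᵢyⱼ}} is where the only unconditional results with trdeg ≥ 2 live: Gelfond1949 (α^β,
α^{β²} for cubic β), Chudnovsky1984 (Thm 1.14/1.15), Philippon1986 (criterion + zero estimate on 𝔾ₐ
× 𝔾ₘⁿ), Diaz1989 (trdeg ℚ(α^β, …, α^{β^{d−1}}) ≥ ⌊(d+1)/2⌋ = NesterenkoPhilippon2001 Ch.14 Cor 2.8),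
Nesterenko1996 (π, e^π via the modular grid), and the large-transcendence-degree theorem t₂ ≥
dℓ/(ℓ+d) under the Technical Hypothesis (NesterenkoPhilippon2001 Ch.14 Thm 2.7; Waldschmidt2000 Ch.
12–15). The conjectural value on the grid is dℓ − (≤ d + ℓ); the thesis packages Schanuel as the d =
1 column with the PRODUCTS xᵢyⱼ ℚ-free, so X ⟺ Schanuel (⇐
Literature.Barriers.Schanuel.cartesianSchanuel_of_schanuel; ⇒ the kernel-checked deciding theorem
`closes`, d = 1, x = ![1]), progress is a monotone numerical frontier (proved exponent vs dℓ), and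
every rung is a Lean item over Mathlib alone — the route imports no Literature module (the 12
unproved names in its cone are the [status: open] conjectures of PeriodsWave0.lean, used by no item,
arriving only through the operator-owned Statement file's import). What it does that other Schanuel
routes do not: its items ARE the classical exponential-grid statements (RoyCriterion attacks the
same numbers through Roy's equivalent criterion; the other grid/tower routes ClusterRankDrop and
GelfondTowers were retired not-a-thesis on 2026-08-15 because their assemblies stopped below the
Statement — this one reaches it, by `closes`, and re-homes ClusterRankDrop's (T.H.)-removal target
as crux #4). Considered and not used: probabilistic models (Schanuel holds Lebesgue-a.e., no
transfer mechanism); physical analogies (none with a dictionary); the modular/elliptic grid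
(Nesterenko1996) — a parallel ladder, layer 2.

RANKED CRUXES. #0 CartesianSchanuelThesis (target) — X above (why it might fail: X ⟺ Schanuel, so it
fails iff the summit does; and it outruns the method — proved reach is t₂ ≥ 2 unconditionally and ≈
dℓ/(ℓ+d) under (T.H.), even the method's own Conj 2.3 stops at [dℓ/(ℓ+d)] + 1 ≪ dℓ;
NesterenkoPhilippon2001 Ch.14 Conj 2.3 / Thm 2.7 / Thm 2.9, Waldschmidt2004 §3.1). #2
LogAlphaAlphaBetaAlgIndep (crux) — for algebraic α ∉ {0,1} (encoded e^l = α, l ≠ 0) and algebraic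
irrational β, log α and α^β = e^{βl} are algebraically independent; grid point d = 2 (x = (1, β)), ℓ
= 1 (y = (l)); = Schanuel n = 2 at (l, βl) (why it might fail: a relation P(log 2, 2^√2) = 0 would
refute the summit; as a rung it sits below the method's entrance condition dℓ > d + ℓ — Thm 2.9
gives nothing on a 2×1 grid — and the one proved instance, α a root of unity with β imaginary
quadratic, is Nesterenko's modular theorem, whose scope does not extend; sources Chudnovsky1984
p.307 Problem P1, NesterenkoPhilippon2001 Ch.14 p.235 and Thm 2.9, Nesterenko1996, arXiv:2505.20957
§1, Waldschmidt2004 §3.1 = arXiv:math/0312440). #3 GelfondDiazLadderFull (crux) — β algebraic of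
degree d ≥ 2 ((minpoly ℚ β).natDegree = d), α = e^l algebraic, l ≠ 0 ⇒ trdeg ℚ(α^β, …, α^{β^{d−1}})
≥ d − 1, the conjecture Gel'fond announced in 1948; Schanuel at x = (l, βl, …, β^{d−1}l) (why it
might fail: every proof since Gelfond1949 yields ⌊(d+1)/2⌋, "half of what is expected" — Diaz1989 =
NesterenkoPhilippon2001 Cor 2.8, arXiv:0908.3973 Thm 34 — because the criteria lose a factor ≈ 2 (t
≥ dℓ/(ℓ+d) at ℓ = d); the first open case d = 4 already needs the full value 3; sources Diaz1989,
NesterenkoPhilippon2001 Ch.14 Cor 2.8 pp.249–250, Chudnovsky1984 p.308 Thm 1.14/1.15, Gelfond1949).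
#4 LargeTrdegWithoutTH (crux, stmt-Schanuel-10491, added in this repair) — for ℚ-linearly
independent x ∈ ℂ^d, y ∈ ℂ^ℓ with ℓ + d < dℓ, trdeg ℚ(e^{xᵢyⱼ}) ≥ [dℓ/(ℓ+d)]: the t-clause of
NesterenkoPhilippon2001 Ch.14 Thm 2.7 (Diaz1989, integer form by the Remark p.248) with both
Technical Hypotheses (Definition 2.6) deleted, = Conj 2.3's t-clause (p.247) off the
four-exponentials cell d = ℓ = 2; Schanuel ⇒ it is kernel-checked
(Literature.Barriers.Schanuel.conj_2_3_t_of_schanuel, planner Sketch2.lean); this is the move the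
method must make and the item retriage found missing; its former home ClusterRankDrop (weaker
(dℓ−1)/(ℓ+d)) was retired not-a-thesis (why it might fail: false only with Schanuel; as a method
target every (T.H.)-free result in print stops at trdeg 2 — Thm 2.9 and p.249 'the only known
results which do not require a Technical Hypothesis' — Tijdeman's zero estimate removed (T.H.) for t
= 2 only, Brownawell [Bro5] merely weakens it (p.250), Chudnovsky1984's elimination claim pp.133–135
was never accepted, Waldschmidt2004 §3.1 'one of the main obstacles'; sources
NesterenkoPhilippon2001 Ch.14 pp.247–250, Waldschmidt2004 §3.1, Brownawell1987 Thm 6.2,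
Chudnovsky1984, Literature.Barriers.Schanuel.LargeTranscendenceDegree). Ranking: 2 = hardest/most
informative (below the method's entrance condition), 3 = the factor-2 gap, 4 = the most
method-reachable rung.

SUPPORT. Diaz1989 (support, rank 4) — the printed ⌊(d+1)/2⌋ ladder bound, verbatim the named fact
Literature.NumberTheory.Transcendental.diaz_1989 (grounded KNOWN; NesterenkoPhilippon2001 Ch.14 Cor
2.8 p.249), inlined so the route stays Mathlib-only; AlgindepLadderLe3OfDiaz (support, rank 4) —
Diaz1989 ⇒ GelfondDiazLadderFull restricted to d ∈ {2, 3}, where ⌊(d+1)/2⌋ = d − 1 (ℕ-arithmetic,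
provable now: interval_cases d <;> simpa). Assembly (assembly, rank 1) — restated by name as
CartesianSchanuelThesis → Schanuel (was the same implication with X's body inlined, which the glue
audit read as an extra hypothesis); provable now by the d = 1, x = ![1] specialisation that the
deciding theorem `closes` already performs (glue.lean, lake ok) — kept only because the gate keeps
one assembly item per route.

KILL CRITERIA. X ⟺ Schanuel and cruxes #2, #3, #4 are consequences of Schanuel (n = 2 at (l, βl); x
= (l, βl, …, β^{d−1}l); conj_2_3_t_of_schanuel): a refutation of CartesianSchanuelThesis,
LogAlphaAlphaBetaAlgIndep, GelfondDiazLadderFull or LargeTrdegWithoutTH refutes the SUMMIT — close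
--reason refuted:<Decl> and the refuting theorem is ¬Schanuel for every route. A theorem that
Gel'fond's method cannot exceed exponent ⌊(d+1)/2⌋ on the ladder, or that (T.H.) is necessary for t
≥ 3, is not a kill but forces the pivot to the evasions catalogued under
Literature.Barriers.Schanuel.LargeTranscendenceDegree (a Tijdeman-type zero estimate removing (T.H.)
as happened for t = 2; Brownawell's weakening; the simultaneous-approximation conjecture GL326
15.31; Roy's criterion = route RoyCriterion). Mooted by any other route proving Schanuel; the d ≤ 3
range of #3 is settled by AlgindepLadderLe3OfDiaz + diaz_1989 and is not progress.

NOT DECOMPOSED YET. Below #4 LargeTrdegWithoutTH nothing is split at this pass: its foreseen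
children (tenure, k ≤ 3) are (a) Brownawell's intermittent/weakened-(T.H.) theorem as a PROVED
support once typed ([Bro5]; NesterenkoPhilippon2001 Ch.14 p.250, Ch.16), (b) a (T.H.)-free zero
estimate / small-value lemma for exponential polynomials in several variables in the style of
Tijdeman's t = 2 removal (p.249), (c) the glue (a) → (b) → #4; the t₁/t₂ clauses and the '+1' of
Diaz [Dia1] stay out. Below #3 GelfondDiazLadderFull: the d = 4 case (first gap, 2 vs 3) as its own
target and the factor-2 loss of the criteria (t ≥ dℓ/(ℓ+d) at ℓ = d) are layer 2; typing anything
with TechnicalHypothesis / gridField would import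
Literature.Barriers.Schanuel.LargeTranscendenceDegree and is deferred so the cone stays
Mathlib-only. Also deferred: elliptic/modular grids (Nesterenko1996) as a parallel ladder;
quantitative (transcendence-measure) versions; the measure-of-simultaneous-approximation "missing
link" (Waldschmidt2004 §3.1).

CHEAPEST FALSIFIER. For the statements: an integer-relation search (PSLQ at 60 digits, total degree
≤ 8) among the monomials in (log 2, 2^√2) — one relation refutes LogAlphaAlphaBetaAlgIndep and with
it Schanuel; expected empty; not run in this one-shot repair unit (no kit seat), recommended as the
refuter's first move. For the LINE: the lookup "has any unconditional grid result passed t₂ ≥ 2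
without (T.H.), or ⌊(d+1)/2⌋ on the ladder, since 1989?" — answered no by NesterenkoPhilippon2001
Ch.14 Thm 2.9 / Cor 2.8, Waldschmidt2004 §3.1, arXiv:0908.3973 Thm 34 (2009) and arXiv:2505.20957
(2025: still trdeg ≥ 2 on the 2×3 grid, with measures); that immobility is the barrier's content
(LargeTranscendenceDegree, NOT evaded), a re-rank signal rather than a refutation.

NUMBERS. Conjectural grid value t ≥ dℓ − d − ℓ (from Schanuel); proved: t₂ ≥ 2 for dℓ > d + ℓ
unconditionally (NesterenkoPhilippon2001 Ch.14 Thm 2.9); t ≥ [dℓ/(ℓ+d)] and t₂ ≥ dℓ/(ℓ+d) under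
(T.H.) (Thm 2.7, Diaz1989); the method's printed target t₂ > dℓ/(ℓ+d), i.e. [dℓ/(ℓ+d)] + 1 (Conj
2.3); ladder: ⌊(d+1)/2⌋ proved of d − 1 conjectured (Cor 2.8), equal for d ≤ 3, first gap at d = 4
(2 vs 3).

SOURCES. Gelfond1949; Chudnovsky1984; Philippon1986; Diaz1989; Nesterenko1996;
NesterenkoPhilippon2001 Ch. 14 (Conj 2.3 p.247, Thm 2.7 p.248, Cor 2.8 and Thm 2.9 p.249);
Waldschmidt2000 §1.4 and Ch. 12–15; Waldschmidt2004 §3.1 (arXiv:math/0312440); arXiv:0908.3973 Thm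
34; arXiv:2505.20957 §1; Baker1975 p.112; tree:
Literature.Barriers.Schanuel.LargeTranscendenceDegree,
Literature.Barriers.Schanuel.cartesianSchanuel_of_schanuel,
Literature.NumberTheory.Transcendental.diaz_1989.

Novelty: Nearest prior art (searched 2026-08-14: lit search --hybrid "algebraic independence log α α^β", lit
search "Gelfond conjecture α^{β^i} transcendence degree Diaz", lit frontier/bridges Schanuel): the
(d,ℓ)-grid programme is classical — Gelfond1949 (d=3 ladder), Chudnovsky1984 (p.307 Problem P1: log
α vs α^β; p.308 Thm 1.15, ⌊(d+1)/2⌋, "only one half of Schanuel's conjecture"), Philippon1986,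
Diaz1989, surveyed in NesterenkoPhilippon2001 Ch.14 (Conj 2.3, Thm 2.7, Cor 2.8, Thm 2.9); status
unchanged in Waldschmidt2004 §3.1 (arXiv:math/0312440) and arXiv:0908.3973 Thm 34 ("best known
result, due to G. Diaz, proves half of what is expected"); 2025 work on the 2×3 grid is still at
trdeg ≥ 2 plus measures (arXiv:2505.20957). Thesis X is Schanuel applied to the dℓ products (X ⟺
Schanuel; ⇐ is Literature.Barriers.Schanuel.cartesianSchanuel_of_schanuel), hence STRONGER than the
printed grid conjecture (NesterenkoPhilippon2001 Conj 2.3: t₂ > dℓ/(ℓ+d), x and y separately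
independent). Crux LogAlphaAlphaBetaAlgIndep = Chudnovsky's P1 extended to every irrational
algebraic β; crux GelfondDiazLadderFull = Gel'fond's 1948 conjecture (NesterenkoPhilippon2001
p.249). Delta: no new mechanism — an organisational packaging (products-LI hypothesis so that d=1 is
literally the summit; rungs as Lean items giving a monotone proved-exponent-vs-dℓ frontier; Diaz's
bound vendored as Literature.NumberTheory.Transcendental.diaz_1989, the d ≤ 3 residue split off as
AlgindepLadderLe3OfDiaz). Self-assessed g  [refs: math/0312440, 0908.3973, 2505.20957, Gelfond1949, Chudnovsky1984, Philippon1986, Diaz1989, NesterenkoPhilippon2001, Waldschmidt2004]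

Barriers (technique_class: algebraic-independence-method large-transcendence-degree): technique_class: algebraic-independence-method large-transcendence-degree
- Literature.Barriers.Schanuel.LargeTranscendenceDegree (names this thesis): NOT evaded. Beyond
trdeg 2 the several-variables Gel'fond–Schneider method has output only under (T.H.) and only ≈
dℓ/(ℓ+d) (Literature.Barriers.Schanuel.diaz1989_largeTrdeg, smallTrdeg_thm_2_9); even its printed
target WaldschmidtConjecture_2_3 stops at [dℓ/(ℓ+d)]+1, against dℓ here — on the ladder, the
⌊(d+1)/2⌋-vs-(d−1) gap of crux GelfondDiazLadderFull. The bet is a catalogued evasion: a sharper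
zero estimate removing (T.H.) as Tijdeman's did for t = 2, Brownawell's weakening, or the
simultaneous-approximation "missing link" (Waldschmidt2004 §3.1; GL326 Conj 15.31) / Roy's criterion
Literature.NumberTheory.Transcendental.Roy2001_iff — none is an item of this route yet.
- Literature.Barriers.Schanuel.AlgebraicIndependenceOfLogarithms (strength): applies to the target
(X ⟺ Schanuel ⟹ AlgIndepLogarithms); the rungs LogAlphaAlphaBetaAlgIndep / GelfondDiazLadderFull sit
strictly below it (one logarithm l plus exponentials), which is why they are the staffed items.
- Literature.Barriers.Schanuel.NesterenkoModularScope (scope): the only proved instance of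
LogAlphaAlphaBetaAlgIndep (α root of unity, β imaginary quadratic) is modular; that scope does not
reach general (α, β) and the route does not import it.
- Literature.Barriers.Schanuel.LinearSubgroupMethodLimit and the functional / soft-model-theoretic /
E-function / period entri

Novelty grade: known — NOVELTY known (matches the route's own 'no new mechanism — packaging'): mechanism = Gel'fond–Philippon–Diaz several-variables method as in NP2001 Ch.14; X = Schanuel restated on the dℓ products (X ⟺ Schanuel kernel-checked both ways, Consistency.lean on stmt-0089); crux #2 = Chudnovsky P1; #3 = Gel' (refuter refuter-rreview1-Schanuel-AlgIndepMethod-df5196a7-0, 2026-08-15T18:26:52Z; prior: NesterenkoPhilippon2001 Ch.14: Conj 2.3 p.247, Thm 2.7 p.248, Cor 2.8 + Thm 2.9 p.249 (cruxes #3, #4, the method), Chudnovsky1984 p.307 P1, p.308 Thm 1.14/1.15 (crux #2; 'half of Schanuel'), Gelfond1949 zbl:0039.04303 (ladder conjecture 1948; d=3), Diaz1989 doi:10.1016/0022-314x(89)90049-8 (= tree fact diaz_1989, barrier LargeTranscendenceDegree), Waldschmidt2004 §3.1 arXiv:math/0312440, arXiv:090)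

History (route lifecycle, newest last):
- 2026-08-15T16:19:33Z · rev 3: restated Assembly (stmt-Schanuel-0090) — route-repair g2 (glue + schema + cone): (1) DECIDING THEOREM supplied — closes : CartesianSchanuelThesis → LogAlphaAlphaBetaAlgIndep → GelfondDiazLadderFull → L (planner-rbadge-Schanuel-AlgIndepMethod-df5196a7-g2-0)
- 2026-08-16T02:17:18Z · AUTO-CRUX: 2 conjecture-grade item(s) promoted to crux (CartesianSchanuelThesis, AlgindepLadderLe3OfDiaz) — refuter vetting / tiering apply (operator:999:1362873)
- 2026-08-16T04:16:54Z · AUTO-CRUX (backfill): CartesianSchanuelThesis — hypotheses of the deciding theorem that nothing in the route derives are cruxes (operator:999:1085951)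
- 2026-08-23T12:31:15Z · DORMANT — reconciler: no traction for 6.1 d (last activity item-evidence-added at 2026-08-17T10:05:08Z); parked, not closed — `ledger route dormant route-Schanuel-AlgInde (operator:999:3187682)

sub-problem: Schanuel · status: dormant · opened planner-Schanuel-Survey-0 2026-08-13T06:03:34Z · rev 4 · ledger route-Schanuel-AlgIndepMethod
GENERATED by the gate from the ledger (D-0016/17). Provers cite these decls: `theorem foo : Summit.Schanuel.Schanuel.Theses.AlgIndepMethod.<Decl> := …` in Summits/Schanuel/Schanuel/Theorems/<Name>.lean.
-/

namespace Summit.Schanuel.Schanuel.Theses.AlgIndepMethod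

open scoped BigOperators Topology Manifold Classical MeasureTheory ProbabilityTheory Matrix InnerProductSpace ComplexConjugate ContinuousMap
open Filter Set Function TopologicalSpace MeasureTheory

attribute [summit_statement] _root_.Schanuel

open Literature.Periods

/-- item stmt-Schanuel-0089 · crux (kind.auto-crux: conjecture-grade) · rank 0 · open · by planner
why it might fail: X ⟺ Schanuel (⇐: Literature.Barriers.Schanuel.cartesianSchanuel_of_schanuel), so it fails iff Schanuel does; and it outruns the method: proved reach on the grid is t₂ ≥ 2 unconditionally and ≈ dl/(d+l) under (T.H.) (NP2001 Ch.14 Thm 2.9/2.7), even the method's own Conj 2.3 stops at [dl/(d+l)]+1 ≪ dl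
sources: NesterenkoPhilippon2001 Ch.14 Conj 2.3 (pdf p.247), Thm 2.7 (p.248), Thm 2.9 (p.249), Waldschmidt2004 §3.1 (arXiv:math/0312440 p.6), Literature.Barriers.Schanuel.LargeTranscendenceDegree (diaz1989_largeTrdeg, smallTrdeg_thm_2_9, WaldschmidtConjecture_2_3), Baker1975 p.112 (Schanuel as printed)
Several-variables algebraic independence conjecture for exp on the (d,l) grid; d=1, x=(1) is
Schanuel and Schanuel ⇒ X (apply to the products). Unconditional frontier: trdeg ≥ ~dl/(d+l) under a
technical hypothesis (Waldschmidt2000 Ch. 12–15, Diaz1989, Philippon1986, Chudnovsky1976). Sources: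
Waldschmidt2000 §1.3–1.4 and Ch. 15, Diaz1989. -/
@[route_item "route-Schanuel-AlgIndepMethod", crux]
def CartesianSchanuelThesis : Prop :=
  ∀ (d l : ℕ) (x : Fin d → ℂ) (y : Fin l → ℂ), LinearIndependent ℚ (fun p : Fin d × Fin l => x p.1 * y p.2) → ((d * l : ℕ) : Cardinal) ≤ Algebra.trdeg ℚ ↥(IntermediateField.adjoin ℚ (Set.range x ∪ Set.range y ∪ Set.range (fun p : Fin d × Fin l => Complex.exp (x p.1 * y p.2))))

/-- item stmt-Schanuel-0084 · crux · rank 2 · open · by planner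
why it might fail: = Schanuel n=2 at (l, βl): a relation P(log 2, 2^√2)=0 would refute the summit. As a rung it may be unreachable here: Gelfond-type criteria need dl > d+l (a 2×2 grid gives only trdeg ≥ 1; NP2001 Ch.14 Thm 2.9); the one proved case (α root of unity, β imag. quadratic) is modular (Nesterenko1996).
sources: Chudnovsky1984 p.307 Problem P1 (β quadratic), Cor 1.6/1.11 (partial: 2 of 3), NesterenkoPhilippon2001 Ch.14 p.235 (m=n=2 remark: known only for α root of unity, β imaginary quadratic), Thm 2.9, Nesterenko1996 (Literature.Barriers.Schanuel.nesterenko1996_thm_1_1; barrier NesterenkoModularScope), arXiv:2505.20957 §1 (2025: still trdeg ≥ 2 among log α₂/log α₁, α₁^β, α₂^β, with measures), Waldschmidt2004 §3.1 (arXiv:math/0312440)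
For algebraic α ∉ {0,1} (encoded: e^l = α, l ≠ 0) and algebraic irrational β, log α and α^β := e^{β
log α} are algebraically independent. Open even for (log 2, 2^√2). Grid point d=2 (x=(1,β)), l=1
(y=(log α)); = Schanuel n=2 at (l, βl). Sources: Waldschmidt2000 §1.4 open problems, Gelfond1934,
Lang1966. -/
@[route_item "route-Schanuel-AlgIndepMethod", crux]
def LogAlphaAlphaBetaAlgIndep : Prop :=
  ∀ (α β l : ℂ), IsAlgebraic ℚ α → IsAlgebraic ℚ β → β ∉ Set.range ((↑) : ℚ → ℂ) → Complex.exp l = α → l ≠ 0 → AlgebraicIndependent ℚ ![l, Complex.exp (β * l)]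

/-- item stmt-Schanuel-0085 · crux · rank 3 · open · by planner
why it might fail: Open for d ≥ 4 since Gel'fond's 1948 announcement; every proof gives ⌊(d+1)/2⌋, 'half of what is expected' (Diaz1989 = NP2001 Cor 2.8; arXiv:0908.3973 Thm 34): large-trdeg criteria lose a factor ≈2 (t ≥ dl/(d+l) at l = d, under T.H.). First open case d = 4 already needs the full Schanuel value 3.
sources: Diaz1989 (named fact Literature.NumberTheory.Transcendental.diaz_1989, landed; Literature.NumberTheory.Transcendental.diaz_1989_of_gridX reduces it to Thm 2.7), NesterenkoPhilippon2001 Ch.14 Cor 2.8 (p.249: announced by Gel'fond 1948), p.250 ('sharpest known result to date'), Chudnovsky1984 p.308 Thm 1.14/1.15 ('only one half of Schanuel's conjecture'), arXiv:0908.3973 §3.1 Thm 34 (Waldschmidt 2009: best known result proves 'half'), Gelfond1949 (d = 3)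
β algebraic of degree d ≥ 2 (minpoly degree d forces integrality), α = e^l algebraic, l ≠ 0: the d−1
numbers α^{β^k} (1 ≤ k ≤ d−1) are algebraically independent. Known: ≥ ⌊(d+1)/2⌋ (Gelfond1949 d=3;
Diaz1989 general). Follows from Schanuel with x = (l, βl, …, β^{d−1}l). Sources: Diaz1989 Thm,
Gelfond1949, Waldschmidt2000 §15. -/
@[route_item "route-Schanuel-AlgIndepMethod", crux]
def GelfondDiazLadderFull : Prop :=
  ∀ (α β l : ℂ) (d : ℕ), IsAlgebraic ℚ α → (minpoly ℚ β).natDegree = d → 2 ≤ d → Complex.exp l = α → l ≠ 0 → ((d - 1 : ℕ) : Cardinal) ≤ Algebra.trdeg ℚ ↥(IntermediateField.adjoin ℚ (Set.range fun k : Fin (d - 1) => Complex.exp (β ^ (k.val + 1) * l)))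

/-- item stmt-Schanuel-0426 · crux (kind.auto-crux: conjecture-grade) · rank 4 · open · by planner
why it might fail: auto-crux — conjecture-grade statement (docstring avows it ('conjecture')); it is open, so it may simply be false
sources: NesterenkoPhilippon2001 Ch.14 p.235, p.249, refuter-refute-A-0 note 2026-08-13 (3-line proof: interval_cases d <;> simpa)
Reaction to grounder verdict KNOWN on stmt-Schanuel-0086 (Diaz1989 → fact
Literature.NumberTheory.Transcendental.diaz_1989, review-queued, not yet in tree so its body is
inlined as the hypothesis). The Gelfond ladder conjecture (crux stmt-Schanuel-0085, trdeg ≥ d−1)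
restricted to d ∈ {2,3}, where ⌊(d+1)/2⌋ = d−1, so it follows from the hypothesis by ℕ-arithmetic on
the exponent bound (Gelfond–Schneider d=2, Gelfond 1949 d=3). Staffable now; settles the known range
of 0085 and leaves d ≥ 4 as the open residue. When diaz_1989 lands, hypothesis = that constant
verbatim. Sources: Diaz1989, Waldschmidt2000 §15. -/
@[route_item "route-Schanuel-AlgIndepMethod", crux]
def AlgindepLadderLe3OfDiaz : Prop :=
  (∀ (α β l : ℂ) (d : ℕ), IsAlgebraic ℚ α → (minpoly ℚ β).natDegree = d → 2 ≤ d → Complex.exp l = α → l ≠ 0 → (((d + 1) / 2 : ℕ) : Cardinal) ≤ Algebra.trdeg ℚ ↥(IntermediateField.adjoin ℚ (Set.range fun k : Fin (d - 1) => Complex.exp (β ^ (k.val + 1) * l)))) → (∀ (α β l : ℂ) (d : ℕ), IsAlgebraic ℚ α → (minpoly ℚ β).natDegree = d → 2 ≤ d → d ≤ 3 → Complex.exp l = α → l ≠ 0 → ((d - 1 : ℕ) : Cardinal) ≤ Algebra.trdeg ℚ ↥(IntermediateField.adjoin ℚ (Set.range fun k : Fin (d - 1) => Complex.exp (β ^ (k.val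 + 1) * l))))

/-- item stmt-Schanuel-10491 · crux · rank 4 · open · by planner
why it might fail: False only with Schanuel (conj_2_3_t_of_schanuel). As a method target: all (T.H.)-free results in print stop at trdeg 2 (NP2001 Ch.14 Thm 2.9, p.249); Tijdeman's zero estimate removed (T.H.) for t = 2 only, Brownawell merely weakens it (p.250), Chudnovsky's removal never accepted (Waldschmidt2004).
sources: NesterenkoPhilippon2001 Ch.14 Conj 2.3 (PDF p.247), Thm 2.7 + Remark (p.248), §2.3 + Thm 2.9 (p.249: 'the only known results which do not require a Technical Hypothesis'), p.250 (Diaz sharpest known; Brownawell [Bro5] weakening), Waldschmidt2004 §3.1 (arXiv:math/0312440: 'one of the main obstacles is the … technical hypothesis'), Brownawell1987 Thm 6.2, Chudnovsky1984 pp.133–135, Literature.Barriers.Schanuel.LargeTranscendenceDegree (evasions_known, scope_caveats), Literature.Barriers.Schanuel.conj_2_3_t_of_schanuel (Schanuel ⇒ this crux; planner Sketch2.lean rc 0)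
[crux] LARGE TRANSCENDENCE DEGREE WITHOUT THE TECHNICAL HYPOTHESIS — the t-clause of
NesterenkoPhilippon2001 Ch.14 Thm 2.7 (Diaz1989; integer form t ≥ [dℓ/(ℓ+d)] by the Remark, PDF
p.248) with BOTH measures of linear independence (Definition 2.6, T.H.) deleted: for ℚ-linearly
independent x ∈ ℂ^d, y ∈ ℂ^ℓ with ℓ + d < dℓ, trdeg_ℚ ℚ(e^{x_i y_j}) ≥ [dℓ/(ℓ+d)]. Equals the
t-clause of Waldschmidt's Conjecture 2.3 (p.247) on the range ℓ + d < dℓ, i.e. d, ℓ ≥ 2 minus the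
four-exponentials cell d = ℓ = 2 (so it does NOT contain
Literature.NumberTheory.Transcendental.FourExponentialsConjecture; 2×3 is six exponentials, 4×4 is
Thm 2.9). This is the mechanism the thesis bets on (barrier LargeTranscendenceDegree,
evasions_known: Tijdeman-type zero estimate / Brownawell weakening) and which retriage 2026-08-14
flagged as having no item; its former home route ClusterRankDrop (weaker target (dℓ−1)/(ℓ+d)) was
retired not-a-thesis 2026-08-15, this route decides the summit. Below the summit: Schanuel → this is
kernel-checked in the planner sketch (Sketch2.lean) from
Literature.Barriers.Schanuel.conj_2_3_t_of_schanuel + one_le_of_add_lt_mul; Mathlib-only statement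
(no import, cone unchanged). Complem -/
@[route_item "route-Schanuel-AlgIndepMethod", crux]
def LargeTrdegWithoutTH : Prop :=
  ∀ (d l : ℕ) (x : Fin d → ℂ) (y : Fin l → ℂ), LinearIndependent ℚ x → LinearIndependent ℚ y → l + d < d * l → ((d * l / (l + d) : ℕ) : Cardinal) ≤ Algebra.trdeg ℚ ↥(IntermediateField.adjoin ℚ (Set.range (fun p : Fin d × Fin l => Complex.exp (x p.1 * y p.2))))

/-- item stmt-Schanuel-0086 · support · rank 4 · open · by planner
sources: NesterenkoPhilippon2001 Ch.14 Cor 2.8 p.249 (verbatim), Diaz1989, Literature.NumberTheory.Transcendental.diaz_1989 (Literature/NumberTheory/Transcendental/DiazLadder.lean)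
Diaz1989 (J. Number Theory 31) main theorem: for β algebraic of degree d ≥ 2 and α algebraic ≠ 0,1,
trdeg_ℚ ℚ(α^β, α^{β²}, …, α^{β^{d−1}}) ≥ ⌊(d+1)/2⌋. Published theorem; expected disposition:
grounder marks 'known → Literature fact', after which #3 is attacked with (h : diaz_1989). Sources:
Diaz1989, Waldschmidt2000 §15. -/
@[route_item "route-Schanuel-AlgIndepMethod", crux]
def Diaz1989 : Prop :=
  ∀ (α β l : ℂ) (d : ℕ), IsAlgebraic ℚ α → (minpoly ℚ β).natDegree = d → 2 ≤ d → Complex.exp l = α → l ≠ 0 → (((d + 1) / 2 : ℕ) : Cardinal) ≤ Algebra.trdeg ℚ ↥(IntermediateField.adjoin ℚ (Set.range fun k : Fin (d - 1) => Complex.exp (β ^ (k.val + 1) * l)))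

-- earlier Assembly (stmt-Schanuel-0090, replaced 2026-08-15T16:19:33Z -> stmt-Schanuel-10619): retired by None — (∀ (d l : ℕ) (x : Fin d → ℂ) (y : Fin l → ℂ), LinearIndependent ℚ (fun p : Fin d × Fin l => x p.1 * y p.2) → ((d * l : ℕ) : Cardinal) ≤ Algebra.trdeg ℚ ↥(IntermediateField.adjoin ℚ (Set.range x ∪ Set.range y ∪ Set.range (fun p : Fin d × Fin l => Complex.exp (x p.1 * y p.2))))) → Schanuel
/-- item stmt-Schanuel-10619 · assembly · rank 1 · open · by planner
[assembly] X → Schanuel, stated BY NAME (was the same implication with the body of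
CartesianSchanuelThesis inlined — the glue.extra-hypothesis finding of the 2026-08-15 audit).
Provable now (bookkeeping, any idle prover): specialise d = 1, x = ![1]; the products ![1] p.1 · y
p.2 are y p.2 (reindex along Equiv.uniqueProd : Fin 1 × Fin l ≃ Fin l, so LinearIndependent
transfers by .comp), Set.range ![1] = {1} (Matrix.range_cons_empty) adds nothing to ℚ(y, e^y)
(one_mem + IntermediateField.adjoin_le_iff / adjoin.mono), and ((1 * l : ℕ) : Cardinal) = l —
exactly the proof the route's deciding theorem `closes` performs (kernel-checked; nothing in the
route waits on this item). Sources: Waldschmidt2000 §1.4;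
Literature.Barriers.Schanuel.cartesianSchanuel_of_schanuel (the converse). -/
@[route_item "route-Schanuel-AlgIndepMethod", crux]
def Assembly : Prop :=
  CartesianSchanuelThesis → Schanuel

/-! D-0027 §2.1 — DECIDING THEOREM (planner-authored via `route open/edit --closes-file`; by planner-rbadge-Schanuel-AlgIndepMethod-df5196a7-g2-0 2026-08-15T16:19:33Z):
its hypotheses are this route's items and its conclusion the sub-problem Statement (glue_lint), and it elaborates with this file. -/

/-- D-0027 §2.1 deciding theorem of route AlgIndepMethod: hypotheses = the route's items (target
`CartesianSchanuelThesis`; cruxes `LogAlphaAlphaBetaAlgIndep`, `GelfondDiazLadderFull`, `LargeTrdegWithoutTH`;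
supports `Diaz1989`, `AlgindepLadderLe3OfDiaz`; the bookkeeping item `Assembly`), conclusion = the sub-problem
Statement `Schanuel`. Content (kernel-checked, axioms propext / Classical.choice / Quot.sound): the target at
`d = 1`, `x = ![1]` IS Schanuel — the products `1 · zⱼ` are the `zⱼ` (reindex along
`Equiv.uniqueProd : Fin 1 × Fin n ≃ Fin n`), `Set.range ![1] = {1}` adds nothing to the field `ℚ(z, e^z)`
(`one_mem`), and `(1 * n : ℕ) = n`. Proved here directly from `hX`: neither `Assembly` (the same implication, kept
as a provable-now bookkeeping item) nor the rungs below the target (log α ⊥ α^β, the Gel'fond–Diaz ladder, large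
transcendence degree without the Technical Hypothesis) nor the two supports are used — they are hypotheses only
because they are items. -/
@[closes "route-Schanuel-AlgIndepMethod"] theorem closes (hX : CartesianSchanuelThesis) (_hLog : LogAlphaAlphaBetaAlgIndep)
    (_hLadder : GelfondDiazLadderFull) (_hNoTH : LargeTrdegWithoutTH) (_hDiaz : Diaz1989)
    (_hLe3 : AlgindepLadderLe3OfDiaz) (_hAssembly : Assembly) : _root_.Schanuel := by
  intro n z hz
  -- the `d = 1`, `x = ![1]` instance of the Cartesian thesis: the products `![1] p.1 * z p.2` are `z p.2`
  have hli : LinearIndependent ℚ (fun p : Fin 1 × Fin n => (![(1 : ℂ)] : Fin 1 → ℂ) p.1 * z p.2) := by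
    have h1 : (fun p : Fin 1 × Fin n => (![(1 : ℂ)] : Fin 1 → ℂ) p.1 * z p.2)
        = z ∘ (Equiv.uniqueProd (Fin n) (Fin 1)) := by
      funext p; simp
    rw [h1]
    exact hz.comp _ (Equiv.injective _)
  -- `{1} ∪ range z ∪ range (e^z ∘ snd)` generates the same intermediate field as `range z ∪ range (e^z)`
  have hE : IntermediateField.adjoin ℚ (Set.range (![(1 : ℂ)] : Fin 1 → ℂ) ∪ Set.range z ∪
        Set.range (fun p : Fin 1 × Fin n => Complex.exp ((![(1 : ℂ)] : Fin 1 → ℂ) p.1 * z p.2)))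
      = IntermediateField.adjoin ℚ (Set.range z ∪ Set.range (Complex.exp ∘ z)) := by
    have hr1 : Set.range (![(1 : ℂ)] : Fin 1 → ℂ) = {1} := by
      rw [Matrix.range_cons_empty]
    have hr2 : Set.range (fun p : Fin 1 × Fin n => Complex.exp ((![(1 : ℂ)] : Fin 1 → ℂ) p.1 * z p.2))
        = Set.range (Complex.exp ∘ z) := by
      have h2 : (fun p : Fin 1 × Fin n => Complex.exp ((![(1 : ℂ)] : Fin 1 → ℂ) p.1 * z p.2))
          = (Complex.exp ∘ z) ∘ (Prod.snd : Fin 1 × Fin n → Fin n) := by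
        funext p; simp
      rw [h2, Prod.snd_surjective.range_comp]
    rw [hr1, hr2]
    apply le_antisymm
    · rw [IntermediateField.adjoin_le_iff]
      rintro t ((rfl | ht) | ht)
      · exact one_mem _
      · exact IntermediateField.subset_adjoin ℚ _ (Or.inl ht)
      · exact IntermediateField.subset_adjoin ℚ _ (Or.inr ht)
    · apply IntermediateField.adjoin.mono
      rintro t (ht | ht)
      · exact Or.inl (Or.inr ht)
      · exact Or.inr ht
  calc (n : Cardinal) = ((1 * n : ℕ) : Cardinal) := by simp
    _ ≤ Algebra.trdeg ℚ ↥(IntermediateField.adjoin ℚ (Set.range (![(1 : ℂ)] : Fin 1 → ℂ) ∪ Set.range z ∪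
          Set.range (fun p : Fin 1 × Fin n => Complex.exp ((![(1 : ℂ)] : Fin 1 → ℂ) p.1 * z p.2)))) :=
        hX 1 n ![1] z hli
    _ = Algebra.trdeg ℚ ↥(IntermediateField.adjoin ℚ (Set.range z ∪ Set.range (Complex.exp ∘ z))) := by
        rw [hE]

end Summit.Schanuel.Schanuel.Theses.AlgIndepMethod
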